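import Mathlib.FieldTheory.KummerPolynomial
import Mathlib.FieldTheory.IntermediateField.Adjoin.Basic
import Mathlib.RingTheory.AdjoinRoot
import Mathlib.LinearAlgebra.Dimension.Free
import Mathlib.FieldTheory.Minpoly.Field
import Mathlib.FieldTheory.Tower
import HarnessLib

/-!
# CAPELLI–KUMMER IRREDUCIBILITY OF THE SEXTIC `X⁶ + sX³ + t` (field-theoretic core of «(f₂) is prime», Q6 calibration)
# (crux `FInjectiveMacaulayfication`, CN engine calibration Q6 = `stub_q6CNFiModel_char5`; CRUX-PLAN v7 R7.3′, seat res-L1-w45a-stub-3)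

Support file for crux stmt-ResolutionOfSingularities-15315. [OURS · L1 W4.5a] — NOT a statement of the manuscript; AI-written,
weaker than expert review.

For a field `F` with `2 ≠ 0` and `s t : F` such that `Δ = s² − 4t` is not a square in `F` and `t` is not a cube in `F`, the sextic
`X⁶ + sX³ + t ∈ F[X]` is IRREDUCIBLE (`irreducible_sextic`). Proof (Capelli's lemma by hand, everything in Mathlib's API):
`L = F(σ)`, `σ² = Δ`, is a quadratic field (Kummer, `p = 2`); `θ = (−s + σ)/2 ∈ L` is a root of `u² + su + t` with `θ·θ̄ = t`
(`θ̄` the conjugate); `θ` is not a cube in `L` — else `t = (γγ̄)³` with `γγ̄ ∈ F` (the conjugation fixes only `F`, as `2 ≠ 0`); so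
`M = L(∛θ)` is a cubic field over `L` (Kummer, `p = 3`), `[M : F] = 6`, `M = F(γ)` (`σ = 2γ³ + s`), and `γ` is a root of the monic
sextic, which is therefore its minimal polynomial (`irreducible_sextic_of_tower`, stated for an abstract tower `F ⊆ L ⊆ M`).
Used by `Q6Prime` with `F = k(x,y)`, `s = x³+y³`, `t = x³y³+x⁸+y⁸` (`f₂ = z⁶ + s z³ + t`). No definitions, no named facts. [folklore]
-/

-- single-problem summit: the doubled namespace component is forced
set_option linter.dupNamespace false

noncomputable section

open Polynomial

namespace Summit.ResolutionOfSingularities.ResolutionOfSingularities.Theorems.FInjectiveMacaulayfication.Q6PrimeTower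

/-! ## The sextic over an abstract tower `F ⊆ L ⊆ M` -/


/-- The sextic is monic. [folklore] -/
theorem sextic_monic {F : Type} [Field F] (s t : F) : (X ^ 6 + C s * X ^ 3 + C t : F[X]).Monic := by
  have h : (X ^ 6 + C s * X ^ 3 + C t : F[X]) = X ^ 6 + (C s * X ^ 3 + C t) := by ring
  rw [h]
  refine (monic_X_pow 6).add_of_left ?_
  refine (degree_add_le _ _).trans_lt ?_
  rw [max_lt_iff, degree_X_pow]
  refine ⟨(degree_C_mul_X_pow_le 3 s).trans_lt (by exact_mod_cast (by norm_num : (3 : ℕ) < 6)), (degree_C_le).trans_lt ?_⟩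
  exact_mod_cast (by norm_num : (0 : ℕ) < 6)

/-- The sextic has degree `6`. [folklore] -/
theorem sextic_natDegree {F : Type} [Field F] (s t : F) : (X ^ 6 + C s * X ^ 3 + C t : F[X]).natDegree = 6 := by
  have h : (X ^ 6 + C s * X ^ 3 + C t : F[X]) = X ^ 6 + (C s * X ^ 3 + C t) := by ring
  rw [h, natDegree_add_eq_left_of_degree_lt, natDegree_X_pow]
  rw [degree_X_pow]
  refine (degree_add_le _ _).trans_lt ?_
  rw [max_lt_iff]
  refine ⟨(degree_C_mul_X_pow_le 3 s).trans_lt (by exact_mod_cast (by norm_num : (3 : ℕ) < 6)), (degree_C_le).trans_lt ?_⟩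
  exact_mod_cast (by norm_num : (0 : ℕ) < 6)

/-- **`M = F(γ)`** for a tower `F ⊆ L = F[θ] ⊆ M = L[γ]` with `γ³ = θ`. [folklore] -/
theorem adjoin_simple_eq_top_of_tower {F L M : Type} [Field F] [Field L] [Field M] [Algebra F L] [Algebra L M] [Algebra F M]
    [IsScalarTower F L M] (θ : L) (hLgen : Algebra.adjoin F {θ} = ⊤)
    (γ : M) (hγ : γ ^ 3 = algebraMap L M θ) (hMgen : Algebra.adjoin L {γ} = ⊤) :
    IntermediateField.adjoin F ({γ} : Set M) = ⊤ := by
  rw [eq_top_iff]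
  intro x _
  have hγmem : γ ∈ IntermediateField.adjoin F ({γ} : Set M) := IntermediateField.mem_adjoin_simple_self F γ
  have hθγ : algebraMap L M θ ∈ IntermediateField.adjoin F ({γ} : Set M) := by
    rw [← hγ]
    exact pow_mem hγmem 3
  have hLsub : ∀ l : L, algebraMap L M l ∈ IntermediateField.adjoin F ({γ} : Set M) := by
    intro l
    have hl : l ∈ Algebra.adjoin F ({θ} : Set L) := by rw [hLgen]; exact Algebra.mem_top
    refine Algebra.adjoin_induction (fun y hy => ?_) (fun r => ?_) (fun _ _ _ _ ha hb => ?_) (fun _ _ _ _ ha hb => ?_) hl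
    · rw [Set.mem_singleton_iff] at hy
      rw [hy]; exact hθγ
    · rw [← IsScalarTower.algebraMap_apply]
      exact (IntermediateField.adjoin F ({γ} : Set M)).algebraMap_mem r
    · rw [map_add]; exact add_mem ha hb
    · rw [map_mul]; exact mul_mem ha hb
  have hx : x ∈ Algebra.adjoin L ({γ} : Set M) := by rw [hMgen]; exact Algebra.mem_top
  refine Algebra.adjoin_induction (fun y hy => ?_) (fun l => hLsub l) (fun _ _ _ _ ha hb => add_mem ha hb)
    (fun _ _ _ _ ha hb => mul_mem ha hb) hx
  rw [Set.mem_singleton_iff] at hy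
  rw [hy]
  exact hγmem

/-- **The sextic `X⁶ + sX³ + t` is irreducible over `F`** as soon as there is a tower `F ⊆ L ⊆ M` of fields with `[L:F] = 2`,
`[M:L] = 3`, `L = F[θ]` for a root `θ` of `u² + su + t`, and `M = L[γ]` with `γ³ = θ`: then `γ` is a root of the sextic of degree
`6 = [M:F] = [F(γ):F]`. [folklore] -/
theorem irreducible_sextic_of_tower {F L M : Type} [Field F] [Field L] [Field M] [Algebra F L] [Algebra L M] [Algebra F M]
    [IsScalarTower F L M] (hL : Module.finrank F L = 2) (hM : Module.finrank L M = 3)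
    (s t : F) (θ : L) (hθ : θ ^ 2 + algebraMap F L s * θ + algebraMap F L t = 0)
    (hLgen : Algebra.adjoin F {θ} = ⊤)
    (γ : M) (hγ : γ ^ 3 = algebraMap L M θ) (hMgen : Algebra.adjoin L {γ} = ⊤) :
    Irreducible (X ^ 6 + C s * X ^ 3 + C t : F[X]) := by
  have hM6 : Module.finrank F M = 6 := by
    rw [← Module.finrank_mul_finrank F L M, hL, hM]
  haveI : FiniteDimensional F M := Module.finite_of_finrank_pos (by rw [hM6]; norm_num)
  have htop := adjoin_simple_eq_top_of_tower θ hLgen γ hγ hMgen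
  have hint : IsIntegral F γ := Algebra.IsIntegral.isIntegral γ
  have hdeg : (minpoly F γ).natDegree = 6 := by
    rw [← IntermediateField.adjoin.finrank hint, htop, IntermediateField.finrank_top', hM6]
  have hroot : aeval γ (X ^ 6 + C s * X ^ 3 + C t : F[X]) = 0 := by
    have h1 : aeval γ (X ^ 6 + C s * X ^ 3 + C t : F[X]) =
        algebraMap L M (θ ^ 2 + algebraMap F L s * θ + algebraMap F L t) := by
      rw [map_add, map_add, map_mul, map_pow, map_pow, aeval_X, aeval_C, aeval_C, show (6 : ℕ) = 3 * 2 from rfl,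
        pow_mul, hγ, map_add, map_add, map_mul, map_pow, ← IsScalarTower.algebraMap_apply,
        ← IsScalarTower.algebraMap_apply]
    rw [h1, hθ, map_zero]
  have heq : X ^ 6 + C s * X ^ 3 + C t = minpoly F γ :=
    eq_of_monic_of_dvd_of_natDegree_le (minpoly.monic hint) (sextic_monic s t) (minpoly.dvd F _ hroot)
      (by rw [sextic_natDegree, hdeg])
  rw [heq]
  exact minpoly.irreducible hint

/-! ## The quadratic field `L = F(σ)`, `σ² = Δ`, and its conjugation -/

variable {F : Type} [Field F]

/-- `X² − Δ` is irreducible when `Δ` is not a square (Kummer, `p = 2`). [folklore] -/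
theorem irreducible_X_sq_sub_C (Δ : F) (hΔ : ∀ d : F, d ^ 2 ≠ Δ) : Irreducible (X ^ 2 - C Δ : F[X]) :=
  (X_pow_sub_C_irreducible_iff_of_prime Nat.prime_two).mpr hΔ

/-- Every element of `F[X]/(X² − Δ)` is `a + b·σ`. [folklore] -/
theorem exists_eq_add_mul_root (Δ : F) (u : AdjoinRoot (X ^ 2 - C Δ : F[X])) :
    ∃ a b : F, u = algebraMap F _ a + algebraMap F _ b * AdjoinRoot.root (X ^ 2 - C Δ : F[X]) := by
  induction u using AdjoinRoot.induction_on with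
  | ih p =>
    have hmonic : (X ^ 2 - C Δ : F[X]).Monic := monic_X_pow_sub_C Δ two_ne_zero
    have hdeg : (p %ₘ (X ^ 2 - C Δ : F[X])).degree ≤ 1 := by
      have h1 := degree_modByMonic_lt p hmonic
      rw [degree_X_pow_sub_C (by norm_num) Δ] at h1
      exact Order.le_of_lt_succ (by exact_mod_cast h1)
    refine ⟨(p %ₘ (X ^ 2 - C Δ : F[X])).coeff 0, (p %ₘ (X ^ 2 - C Δ : F[X])).coeff 1, ?_⟩
    have hmk : AdjoinRoot.mk (X ^ 2 - C Δ : F[X]) p = AdjoinRoot.mk (X ^ 2 - C Δ : F[X]) (p %ₘ (X ^ 2 - C Δ)) := by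
      rw [AdjoinRoot.mk_eq_mk, modByMonic_eq_sub_mul_div p, sub_sub_cancel]
      exact dvd_mul_right _ _
    rw [hmk]
    conv_lhs => rw [eq_X_add_C_of_degree_le_one hdeg]
    rw [map_add, map_mul, AdjoinRoot.mk_C, AdjoinRoot.mk_C, AdjoinRoot.mk_X, AdjoinRoot.algebraMap_eq, add_comm]

/-- `σ² = Δ` in `F[X]/(X² − Δ)`. [folklore] -/
theorem root_sq (Δ : F) :
    (AdjoinRoot.root (X ^ 2 - C Δ : F[X])) ^ 2 = algebraMap F (AdjoinRoot (X ^ 2 - C Δ : F[X])) Δ := by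
  have h := AdjoinRoot.eval₂_root (X ^ 2 - C Δ : F[X])
  rw [eval₂_sub, eval₂_X_pow, eval₂_C, sub_eq_zero] at h
  rw [h, AdjoinRoot.algebraMap_eq]

/-- **The conjugation of `F(σ)`**: an `F`-algebra endomorphism with `σ ↦ −σ`, an involution. [folklore] -/
theorem exists_conj (Δ : F) :
    ∃ τ : AdjoinRoot (X ^ 2 - C Δ : F[X]) →ₐ[F] AdjoinRoot (X ^ 2 - C Δ : F[X]),
      τ (AdjoinRoot.root (X ^ 2 - C Δ : F[X])) = - AdjoinRoot.root (X ^ 2 - C Δ : F[X]) ∧ ∀ u, τ (τ u) = u := by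
  have hroot : (X ^ 2 - C Δ : F[X]).eval₂ (Algebra.ofId F (AdjoinRoot (X ^ 2 - C Δ : F[X])))
      (- AdjoinRoot.root (X ^ 2 - C Δ : F[X])) = 0 := by
    rw [eval₂_sub, eval₂_X_pow, eval₂_C, neg_sq, root_sq, sub_eq_zero]
    rfl
  refine ⟨AdjoinRoot.liftAlgHom _ (Algebra.ofId F _) _ hroot, AdjoinRoot.liftAlgHom_root _ _ _ _, ?_⟩
  have hcomp : (AdjoinRoot.liftAlgHom (X ^ 2 - C Δ : F[X]) (Algebra.ofId F _) _ hroot).comp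
      (AdjoinRoot.liftAlgHom (X ^ 2 - C Δ : F[X]) (Algebra.ofId F _) _ hroot) = AlgHom.id F _ := by
    refine AdjoinRoot.algHom_ext ?_
    rw [AlgHom.comp_apply, AdjoinRoot.liftAlgHom_root, map_neg, AdjoinRoot.liftAlgHom_root, neg_neg, AlgHom.id_apply]
  intro u
  have h := congrArg (fun φ : AdjoinRoot (X ^ 2 - C Δ : F[X]) →ₐ[F] AdjoinRoot (X ^ 2 - C Δ : F[X]) => φ u) hcomp
  simpa using h

/-- **Fixed points of the conjugation lie in `F`** (`2 ≠ 0`, `Δ ≠ 0`). [folklore] -/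
theorem exists_algebraMap_eq_of_fixed (h2 : (2 : F) ≠ 0) (Δ : F) (hΔ0 : Δ ≠ 0) [Fact (Irreducible (X ^ 2 - C Δ : F[X]))]
    (τ : AdjoinRoot (X ^ 2 - C Δ : F[X]) →ₐ[F] AdjoinRoot (X ^ 2 - C Δ : F[X]))
    (hτ : τ (AdjoinRoot.root (X ^ 2 - C Δ : F[X])) = - AdjoinRoot.root (X ^ 2 - C Δ : F[X]))
    (u : AdjoinRoot (X ^ 2 - C Δ : F[X])) (hu : τ u = u) : ∃ a : F, u = algebraMap F _ a := by
  obtain ⟨a, b, rfl⟩ := exists_eq_add_mul_root Δ u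
  refine ⟨a, ?_⟩
  rw [map_add, map_mul, AlgHom.commutes, AlgHom.commutes, hτ] at hu
  have hσ0 : AdjoinRoot.root (X ^ 2 - C Δ : F[X]) ≠ 0 := by
    intro h0
    have h1 := root_sq Δ
    rw [h0, zero_pow two_ne_zero] at h1
    exact hΔ0 ((algebraMap F (AdjoinRoot (X ^ 2 - C Δ : F[X]))).injective (by rw [map_zero]; exact h1)).symm
  have hb : algebraMap F (AdjoinRoot (X ^ 2 - C Δ : F[X])) b = 0 := by
    have h3 : (2 : AdjoinRoot (X ^ 2 - C Δ : F[X])) * (algebraMap F _ b * AdjoinRoot.root (X ^ 2 - C Δ : F[X])) = 0 := by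
      linear_combination (-1 : AdjoinRoot (X ^ 2 - C Δ : F[X])) * hu
    have h2L : (2 : AdjoinRoot (X ^ 2 - C Δ : F[X])) ≠ 0 := by
      rw [show (2 : AdjoinRoot (X ^ 2 - C Δ : F[X])) = algebraMap F _ 2 from (map_ofNat _ 2).symm,
        map_ne_zero_iff _ (algebraMap F _).injective]
      exact h2
    rcases mul_eq_zero.mp h3 with h3 | h3
    · exact absurd h3 h2L
    · rcases mul_eq_zero.mp h3 with h3 | h3
      · exact h3
      · exact absurd h3 hσ0
  rw [hb, zero_mul, add_zero]


/-- `γ³ = θ` in `L[X]/(X³ − θ)`. [folklore] -/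
theorem root_sq_aux {L : Type} [Field L] (θ : L) :
    (AdjoinRoot.root (X ^ 3 - C θ : L[X])) ^ 3 = algebraMap L (AdjoinRoot (X ^ 3 - C θ : L[X])) θ := by
  have h := AdjoinRoot.eval₂_root (X ^ 3 - C θ : L[X])
  rw [eval₂_sub, eval₂_X_pow, eval₂_C, sub_eq_zero] at h
  rw [h, AdjoinRoot.algebraMap_eq]

/-! ## The sextic -/

/-- **CAPELLI–KUMMER: `X⁶ + sX³ + t` is irreducible over `F`** when `2 ≠ 0`, `s² − 4t` is not a square and `t` is not a cube
in `F`. [folklore] -/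
theorem irreducible_sextic (h2 : (2 : F) ≠ 0) (s t : F) (hΔ : ∀ d : F, d ^ 2 ≠ s ^ 2 - 4 * t) (ht : ∀ r : F, r ^ 3 ≠ t) :
    Irreducible (X ^ 6 + C s * X ^ 3 + C t : F[X]) := by
  -- the quadratic field `L = F(σ)`
  haveI hfact : Fact (Irreducible (X ^ 2 - C (s ^ 2 - 4 * t) : F[X])) := ⟨irreducible_X_sq_sub_C _ hΔ⟩
  have hΔ0 : s ^ 2 - 4 * t ≠ 0 := fun h => hΔ 0 (by rw [h]; ring)
  have hq0 : (X ^ 2 - C (s ^ 2 - 4 * t) : F[X]) ≠ 0 := (monic_X_pow_sub_C _ two_ne_zero).ne_zero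
  obtain ⟨τ, hτ, hττ⟩ := exists_conj (s ^ 2 - 4 * t)
  have hσ2 : (AdjoinRoot.root (X ^ 2 - C (s ^ 2 - 4 * t) : F[X])) ^ 2 =
      (algebraMap F (AdjoinRoot (X ^ 2 - C (s ^ 2 - 4 * t) : F[X])) s) ^ 2 -
        4 * algebraMap F (AdjoinRoot (X ^ 2 - C (s ^ 2 - 4 * t) : F[X])) t := by
    rw [root_sq]
    simp only [map_sub, map_pow, map_mul, map_ofNat]
  have h2L : (2 : AdjoinRoot (X ^ 2 - C (s ^ 2 - 4 * t) : F[X])) ≠ 0 := by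
    rw [show (2 : AdjoinRoot (X ^ 2 - C (s ^ 2 - 4 * t) : F[X])) = algebraMap F _ 2 from (map_ofNat _ 2).symm,
      map_ne_zero_iff _ (algebraMap F _).injective]
    exact h2
  -- `θ = (−s + σ)/2`
  obtain ⟨θ, hθ_def⟩ : ∃ θ : AdjoinRoot (X ^ 2 - C (s ^ 2 - 4 * t) : F[X]),
      θ = (2 : AdjoinRoot (X ^ 2 - C (s ^ 2 - 4 * t) : F[X]))⁻¹ *
        (- algebraMap F _ s + AdjoinRoot.root (X ^ 2 - C (s ^ 2 - 4 * t) : F[X])) := ⟨_, rfl⟩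
  have hσθ : AdjoinRoot.root (X ^ 2 - C (s ^ 2 - 4 * t) : F[X]) = 2 * θ + algebraMap F _ s := by
    rw [hθ_def, ← mul_assoc, mul_inv_cancel₀ h2L, one_mul, neg_add_cancel_comm]
  have hθ : θ ^ 2 + algebraMap F _ s * θ + algebraMap F _ t = 0 := by
    have h4 : (4 : AdjoinRoot (X ^ 2 - C (s ^ 2 - 4 * t) : F[X])) * (θ ^ 2 + algebraMap F _ s * θ + algebraMap F _ t) = 0 := by
      rw [hσθ] at hσ2
      linear_combination hσ2
    have h4ne : (4 : AdjoinRoot (X ^ 2 - C (s ^ 2 - 4 * t) : F[X])) ≠ 0 := by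
      rw [show (4 : AdjoinRoot (X ^ 2 - C (s ^ 2 - 4 * t) : F[X])) = 2 * 2 by norm_num]
      exact mul_ne_zero h2L h2L
    exact (mul_eq_zero.mp h4).resolve_left h4ne
  have hτθ : θ * τ θ = algebraMap F _ t := by
    have hτθ' : τ θ = (2 : AdjoinRoot (X ^ 2 - C (s ^ 2 - 4 * t) : F[X]))⁻¹ *
        (- algebraMap F _ s + - AdjoinRoot.root (X ^ 2 - C (s ^ 2 - 4 * t) : F[X])) := by
      rw [hθ_def, map_mul, map_add, map_neg, map_inv₀, map_ofNat, AlgHom.commutes, hτ]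
    have h4 : (4 : AdjoinRoot (X ^ 2 - C (s ^ 2 - 4 * t) : F[X])) * (θ * τ θ) = 4 * algebraMap F _ t := by
      have e1 : (4 : AdjoinRoot (X ^ 2 - C (s ^ 2 - 4 * t) : F[X])) * (θ * τ θ) = (2 * θ) * (2 * τ θ) := by ring
      rw [e1, hτθ', ← mul_assoc (2 : AdjoinRoot (X ^ 2 - C (s ^ 2 - 4 * t) : F[X])), mul_inv_cancel₀ h2L, one_mul,
        hθ_def, ← mul_assoc (2 : AdjoinRoot (X ^ 2 - C (s ^ 2 - 4 * t) : F[X])), mul_inv_cancel₀ h2L, one_mul]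
      linear_combination (-1 : AdjoinRoot (X ^ 2 - C (s ^ 2 - 4 * t) : F[X])) * hσ2
    have h4ne : (4 : AdjoinRoot (X ^ 2 - C (s ^ 2 - 4 * t) : F[X])) ≠ 0 := by
      rw [show (4 : AdjoinRoot (X ^ 2 - C (s ^ 2 - 4 * t) : F[X])) = 2 * 2 by norm_num]
      exact mul_ne_zero h2L h2L
    exact mul_left_cancel₀ h4ne h4
  -- `θ` is not a cube in `L`
  have hθcube : ∀ γ : AdjoinRoot (X ^ 2 - C (s ^ 2 - 4 * t) : F[X]), γ ^ 3 ≠ θ := by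
    intro γ hγ
    have hfix : τ (γ * τ γ) = γ * τ γ := by rw [map_mul, hττ, mul_comm (τ γ) γ]
    obtain ⟨r, hr⟩ := exists_algebraMap_eq_of_fixed h2 _ hΔ0 τ hτ _ hfix
    apply ht r
    have h1 : algebraMap F (AdjoinRoot (X ^ 2 - C (s ^ 2 - 4 * t) : F[X])) (r ^ 3) = algebraMap F _ t := by
      rw [map_pow, ← hr, mul_pow, ← map_pow, hγ, hτθ]
    exact (algebraMap F _).injective h1
  -- `L = F[θ]`, `[L : F] = 2`
  have hLgen : Algebra.adjoin F ({θ} : Set (AdjoinRoot (X ^ 2 - C (s ^ 2 - 4 * t) : F[X]))) = ⊤ := by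
    rw [eq_top_iff, ← AdjoinRoot.adjoinRoot_eq_top, Algebra.adjoin_le_iff, Set.singleton_subset_iff, SetLike.mem_coe, hσθ,
      two_mul]
    exact add_mem (add_mem (Algebra.self_mem_adjoin_singleton F θ) (Algebra.self_mem_adjoin_singleton F θ))
      (Subalgebra.algebraMap_mem _ s)
  have hL2 : Module.finrank F (AdjoinRoot (X ^ 2 - C (s ^ 2 - 4 * t) : F[X])) = 2 := by
    rw [(AdjoinRoot.powerBasis hq0).finrank, AdjoinRoot.powerBasis_dim, natDegree_X_pow_sub_C]
  -- the cubic field `M = L(γ)`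
  haveI hfact3 : Fact (Irreducible (X ^ 3 - C θ : (AdjoinRoot (X ^ 2 - C (s ^ 2 - 4 * t) : F[X]))[X])) :=
    ⟨(X_pow_sub_C_irreducible_iff_of_prime Nat.prime_three).mpr hθcube⟩
  have hc0 : (X ^ 3 - C θ : (AdjoinRoot (X ^ 2 - C (s ^ 2 - 4 * t) : F[X]))[X]) ≠ 0 :=
    (monic_X_pow_sub_C _ three_ne_zero).ne_zero
  have hγ3 : (AdjoinRoot.root (X ^ 3 - C θ : (AdjoinRoot (X ^ 2 - C (s ^ 2 - 4 * t) : F[X]))[X])) ^ 3 =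
      algebraMap _ (AdjoinRoot (X ^ 3 - C θ : (AdjoinRoot (X ^ 2 - C (s ^ 2 - 4 * t) : F[X]))[X])) θ := root_sq_aux θ
  have hM3 : Module.finrank (AdjoinRoot (X ^ 2 - C (s ^ 2 - 4 * t) : F[X]))
      (AdjoinRoot (X ^ 3 - C θ : (AdjoinRoot (X ^ 2 - C (s ^ 2 - 4 * t) : F[X]))[X])) = 3 := by
    rw [(AdjoinRoot.powerBasis hc0).finrank, AdjoinRoot.powerBasis_dim, natDegree_X_pow_sub_C]
  exact irreducible_sextic_of_tower hL2 hM3 s t θ hθ hLgen _ hγ3 (AdjoinRoot.adjoinRoot_eq_top)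

end Summit.ResolutionOfSingularities.ResolutionOfSingularities.Theorems.FInjectiveMacaulayfication.Q6PrimeTower

end
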